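import Literature.AlgebraicGeometry.Motives.HodgeLieRigidModuloCentre
import HarnessLib

/-!
# The exact `Θ`-rigidity criterion: a polarizable Hodge structure is `Θ`-rigid iff no non-zero central element of its Hodge Lie
# algebra is trace-orthogonal to the Hodge operator, `tr(c_ℂ Θ) ≠ 0` for `0 ≠ c ∈ 𝔷(𝔥)` (the «trace test» made necessary and sufficient)

Family `hodge`, layer `Literature/AlgebraicGeometry/Motives`.  THEOREMS ONLY (no definition, no named fact).  Written for the
cell `pub-hodgecm2` (COR-CM), seat `b27` gen 54 (count-neutral Mumford–Tate-rank ladder, «rigidity modulo the centre», part 4).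

`H` polarized of weight `n` on a finite-dimensional `V`, `𝔥 = Lie Hg(H)`, `𝔷 = 𝔥 ∩ End_Hdg` (centre), `𝔡 = [𝔥, 𝔥]`, `Θ` the Hodge
operator (`2p − n` on `V^{p,n−p}`).  By part 3 (`Motives/HodgeLieRigidModuloCentre`) every `Θ`-subalgebra `𝔞 ⊆ 𝔥` (bracket-closed,
rational, `Θ ∈ 𝔞 ⊗ ℂ`) contains `𝔡`, so `𝔞 = 𝔡 ⊕ (𝔞 ∩ 𝔷)`; and a central `c` is trace-orthogonal to `𝔡` (`tr(c[X,Y]) = 0`).  Hence: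
* **`rigid_of_forall_center_trace_theta`** — if `tr(c_ℂ ∘ Θ) = 0` forces `c = 0` for central `c`, then `H` is `Θ`-RIGID: were
  `𝔞 ∩ 𝔷 ⊊ 𝔷`, a non-zero central `c` with `tr(c · (𝔞 ∩ 𝔷)) = 0` (dimension count) would satisfy `tr(c 𝔞) = 0`, so `tr(c_ℂ Θ) = 0`.
* **`not_rigid_of_center_trace_theta_eq_zero`** — conversely a non-zero central `c` with `tr(c_ℂ Θ) = 0` yields the PROPER
  `Θ`-subalgebra `𝔡 ⊕ (𝔷 ∩ ker tr(c ·)) ∌ c` (`tr(c²) < 0`, Deligne I 3.6 / Moonen–Zarhin §1: the trace form is definite on the centre).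
* **`rigid_iff_forall_center_trace_theta`** — the equivalence.  The ladder's «trace tests» (`Motives/HodgeLieRigidTimesRankOne{,Family}`,
  `CorCM/MumfordTateRankUnitaryPairCentre`, gens 50–53) are instances: `tr(Θ_A φ^*) = 2i√d (n′ − n″)` (Gordon 1.13.2).

## References
* [Deligne1982HodgeCycles] P. Deligne, LNM 900 (1982), I §3 Prop. 3.4, Prop. 3.6. [cite: Deligne1982HodgeCycles, I §3 Prop. 3.6]
* [MoonenZarhin1999LowDim] B. Moonen, Yu. G. Zarhin, Math. Ann. 315 (1999), §1, §3 (3.1) [corpus: paper:arxiv-math_9901113 pp. 2, 6].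
  [cite: MoonenZarhin1999LowDim, §3 (3.1)]
* [Gordon1997] B. B. Gordon, *A survey of the Hodge conjecture for abelian varieties*, 1.13.2. [cite: Gordon1997, 1.13.2]
* [Humphreys1972] J. E. Humphreys, GTM 9 (1972), §5.1 (trace forms). [cite: Humphreys1972, §5.1]
-/

noncomputable section

open scoped TensorProduct

namespace Literature.AlgebraicGeometry.Motives

namespace HodgeStructure

universe u

variable {V : Type u} [AddCommGroup V] [Module ℚ V] [Module.Finite ℚ V] [HodgeTensorFacts.{u, u}] {n : ℤ}

/-! ### §1 Traces against the complex span -/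

omit [HodgeTensorFacts.{u, u}] in
/-- If `tr(c A) = 0` for all `A ∈ 𝔞` then `tr(c_ℂ Y) = 0` for all `Y` in the complex span of `𝔞`. [cite: Humphreys1972, §5.1] -/
theorem trace_baseChange_mul_eq_zero_of_mem_spanC (𝔞 : Submodule ℚ (Module.End ℚ V)) {c : Module.End ℚ V}
    (hc : ∀ A ∈ 𝔞, LinearMap.trace ℚ V (c * A) = 0) {Y : Module.End ℂ (ℂ ⊗[ℚ] V)}
    (hY : Y ∈ Submodule.span ℂ ((fun X : Module.End ℚ V => X.baseChange ℂ) '' (𝔞 : Set (Module.End ℚ V)))) :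
    LinearMap.trace ℂ (ℂ ⊗[ℚ] V) (c.baseChange ℂ * Y) = 0 := by
  induction hY using Submodule.span_induction with
  | mem Z hZ =>
    obtain ⟨A, hA, rfl⟩ := hZ
    rw [← LinearMap.baseChange_mul, LinearMap.trace_baseChange, hc A hA, map_zero]
  | zero => rw [mul_zero, map_zero]
  | add Z Z' _ _ hZ hZ' => rw [mul_add, map_add, hZ, hZ', add_zero]
  | smul a Z _ hZ => rw [mul_smul_comm, map_smul, hZ, smul_zero]

/-- A central element of `𝔥` is trace-orthogonal to every `Θ`-subalgebra `𝔞` as soon as it is trace-orthogonal to `𝔞 ∩ 𝔷`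
(`𝔞 = 𝔡 ⊕ (𝔞 ∩ 𝔷)`, `tr(c 𝔡) = 0`). [cite: Deligne1982HodgeCycles, I §3 Prop. 3.6] [cite: Humphreys1972, §5.1] -/
theorem trace_mul_eq_zero_of_theta_mem (H : HodgeStructure V n) (ψ : H.Polarization) (𝔞 : Submodule ℚ (Module.End ℚ V))
    (h𝔞 : 𝔞 ≤ H.hodgeLie) (hbr : ∀ X ∈ 𝔞, ∀ Y ∈ 𝔞, X * Y - Y * X ∈ 𝔞)
    (hΘ : ∃ Θ ∈ Submodule.span ℂ ((fun X : Module.End ℚ V => X.baseChange ℂ) '' (𝔞 : Set (Module.End ℚ V))),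
      ∀ p, ∀ x ∈ H.piece p (n - p), Θ x = ((2 * p - n : ℤ) : ℂ) • x)
    {c : Module.End ℚ V} (hc : c ∈ H.hodgeLie ⊓ Subalgebra.toSubmodule H.endAlg)
    (hc𝔞 : ∀ x ∈ 𝔞 ⊓ (H.hodgeLie ⊓ Subalgebra.toSubmodule H.endAlg), LinearMap.trace ℚ V (c * x) = 0) :
    ∀ A ∈ 𝔞, LinearMap.trace ℚ V (c * A) = 0 := by
  intro A hA
  have h𝔡 := derived_le_of_theta_mem H ψ 𝔞 h𝔞 hbr hΘ
  have hA' : A ∈ H.hodgeLie ⊓ Subalgebra.toSubmodule H.endAlg ⊔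
      Submodule.span ℚ {B | ∃ X ∈ H.hodgeLie, ∃ Y ∈ H.hodgeLie, X * Y - Y * X = B} := by
    rw [AnyWeight.hodgeLie_center_sup_derived_eq H ψ]; exact h𝔞 hA
  obtain ⟨x, hx, d, hd, rfl⟩ := Submodule.mem_sup.1 hA'
  have hx𝔞 : x ∈ 𝔞 := by
    have h := 𝔞.sub_mem hA (h𝔡 hd)
    rwa [add_sub_cancel_right] at h
  have hcc : ∀ Y ∈ H.hodgeLie, c * Y = Y * c := fun Y hY =>
    (H.commute_of_mem_hodgeLie hY ⟨c, (Submodule.mem_inf.1 hc).2⟩).symm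
  rw [mul_add, map_add, hc𝔞 x (Submodule.mem_inf.2 ⟨hx𝔞, hx⟩),
    Literature.Algebra.Lie.TraceSeparating.trace_mul_eq_zero_of_central_of_mem_derived H.hodgeLie hcc hd, add_zero]

/-! ### §2 The trace test is sufficient -/

/-- **Rigidity from the trace test**: if every central `c ∈ 𝔥 ∩ End_Hdg` with `tr(c_ℂ ∘ Θ) = 0` vanishes, then `H` is `Θ`-RIGID —
every bracket-closed rational `𝔞 ⊆ 𝔥(H)` whose complex span contains a Hodge operator is `𝔥(H)`.
[cite: MoonenZarhin1999LowDim, §3 (3.1)] [cite: Deligne1982HodgeCycles, I §3 Prop. 3.6] [cite: Gordon1997, 1.13.2] -/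
theorem rigid_of_forall_center_trace_theta (H : HodgeStructure V n) (hH : H.IsPolarizable) {Θ₀ : Module.End ℂ (ℂ ⊗[ℚ] V)}
    (hΘ₀ : ∀ p, ∀ x ∈ H.piece p (n - p), Θ₀ x = ((2 * p - n : ℤ) : ℂ) • x)
    (htest : ∀ c ∈ H.hodgeLie ⊓ Subalgebra.toSubmodule H.endAlg,
      LinearMap.trace ℂ (ℂ ⊗[ℚ] V) (c.baseChange ℂ * Θ₀) = 0 → c = 0) :
    ∀ 𝔞 : Submodule ℚ (Module.End ℚ V), 𝔞 ≤ H.hodgeLie →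
      (∀ X ∈ 𝔞, ∀ Y ∈ 𝔞, X * Y - Y * X ∈ 𝔞) →
      (∃ Θ ∈ Submodule.span ℂ ((fun X : Module.End ℚ V => X.baseChange ℂ) '' (𝔞 : Set (Module.End ℚ V))),
        ∀ p, ∀ x ∈ H.piece p (n - p), Θ x = ((2 * p - n : ℤ) : ℂ) • x) → H.hodgeLie ≤ 𝔞 := by
  classical
  obtain ⟨ψ⟩ := hH
  intro 𝔞 h𝔞 hbr hΘ
  obtain ⟨Θ, hΘmem, hΘ⟩ := hΘ
  have hΘeq : Θ = Θ₀ := linearMap_ext_of_piece H fun p x hx => by rw [hΘ p x hx, hΘ₀ p x hx]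
  set 𝔷 := H.hodgeLie ⊓ Subalgebra.toSubmodule H.endAlg with h𝔷
  refine hodgeLie_le_of_theta_mem_of_center_le H ψ 𝔞 h𝔞 hbr ⟨Θ, hΘmem, hΘ⟩ ?_
  by_contra hnot
  -- `𝔞 ∩ 𝔷 ⊊ 𝔷`: a non-zero central `c` trace-orthogonal to `𝔞 ∩ 𝔷`
  have hlt : Module.finrank ℚ ↥(𝔞 ⊓ 𝔷) < Module.finrank ℚ ↥𝔷 := by
    refine Submodule.finrank_lt_finrank_of_lt (lt_of_le_of_ne inf_le_right fun h => hnot ?_)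
    exact h.symm.le.trans inf_le_left
  let L : ↥𝔷 →ₗ[ℚ] Module.Dual ℚ ↥(𝔞 ⊓ 𝔷) :=
    { toFun := fun c =>
        { toFun := fun x => LinearMap.trace ℚ V ((c : Module.End ℚ V) * (x : Module.End ℚ V))
          map_add' := fun x y => by rw [Submodule.coe_add, mul_add, map_add]
          map_smul' := fun a x => by rw [Submodule.coe_smul, mul_smul_comm, map_smul, RingHom.id_apply] }
      map_add' := fun c c' => by ext x; simp [add_mul]
      map_smul' := fun a c => by ext x; simp }
  have hker : LinearMap.ker L ≠ ⊥ :=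
    LinearMap.ker_ne_bot_of_finrank_lt (by rw [Subspace.dual_finrank_eq]; exact hlt)
  obtain ⟨c, hcL, hc0⟩ := (Submodule.ne_bot_iff _).1 hker
  have hc𝔞 : ∀ x ∈ 𝔞 ⊓ 𝔷, LinearMap.trace ℚ V ((c : Module.End ℚ V) * x) = 0 := fun x hx => by
    have h := LinearMap.congr_fun (LinearMap.mem_ker.1 hcL) ⟨x, hx⟩
    exact h
  have htr𝔞 := trace_mul_eq_zero_of_theta_mem H ψ 𝔞 h𝔞 hbr ⟨Θ, hΘmem, hΘ⟩ c.2 hc𝔞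
  have h0 : LinearMap.trace ℂ (ℂ ⊗[ℚ] V) ((c : Module.End ℚ V).baseChange ℂ * Θ₀) = 0 := by
    rw [← hΘeq]; exact trace_baseChange_mul_eq_zero_of_mem_spanC 𝔞 htr𝔞 hΘmem
  exact hc0 (Subtype.ext (htest c c.2 h0))

/-! ### §3 The trace test is necessary -/

omit [Module.Finite ℚ V] [HodgeTensorFacts.{u, u}] in
/-- The complex span of a sum of rational subspaces is the sum of the complex spans. [cite: Deligne1982HodgeCycles, I §3 Prop. 3.6] -/
theorem spanC_sup_le (𝔞 𝔟 : Submodule ℚ (Module.End ℚ V)) :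
    Submodule.span ℂ ((fun X : Module.End ℚ V => X.baseChange ℂ) '' ((𝔞 ⊔ 𝔟 : Submodule ℚ (Module.End ℚ V)) : Set (Module.End ℚ V))) ≤
      Submodule.span ℂ ((fun X : Module.End ℚ V => X.baseChange ℂ) '' (𝔞 : Set (Module.End ℚ V))) ⊔
        Submodule.span ℂ ((fun X : Module.End ℚ V => X.baseChange ℂ) '' (𝔟 : Set (Module.End ℚ V))) := by
  rw [Submodule.span_le]
  rintro _ ⟨X, hX, rfl⟩
  obtain ⟨a, ha, b, hb, rfl⟩ := Submodule.mem_sup.1 hX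
  change (a + b).baseChange ℂ ∈ _
  rw [LinearMap.baseChange_add]
  exact Submodule.add_mem_sup (Submodule.subset_span ⟨a, ha, rfl⟩) (Submodule.subset_span ⟨b, hb, rfl⟩)

/-- **A non-zero central `c` with `tr(c_ℂ ∘ Θ) = 0` produces a PROPER `Θ`-subalgebra of `𝔥(H)`**, namely
`𝔡 ⊕ (𝔷 ∩ ker tr(c ·))`: it is bracket-closed (central part), contains `Θ = Θ_𝔷 + Θ_𝔡` over `ℂ` (`tr(c_ℂ Θ_𝔡) = 0`, and
`𝔷 = ℚ c ⊕ (𝔷 ∩ ker tr(c ·))` as `tr(c²) < 0`), and misses `c`.  So the trace test is NECESSARY for `Θ`-rigidity.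
[cite: Deligne1982HodgeCycles, I §3 Prop. 3.6] [cite: MoonenZarhin1999LowDim, §3 (3.1)] -/
theorem not_rigid_of_center_trace_theta_eq_zero (H : HodgeStructure V n) (ψ : H.Polarization) {Θ₀ : Module.End ℂ (ℂ ⊗[ℚ] V)}
    (hΘ₀ : ∀ p, ∀ x ∈ H.piece p (n - p), Θ₀ x = ((2 * p - n : ℤ) : ℂ) • x)
    {c : Module.End ℚ V} (hc : c ∈ H.hodgeLie ⊓ Subalgebra.toSubmodule H.endAlg) (hc0 : c ≠ 0)
    (htr : LinearMap.trace ℂ (ℂ ⊗[ℚ] V) (c.baseChange ℂ * Θ₀) = 0) :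
    ∃ 𝔞 : Submodule ℚ (Module.End ℚ V), 𝔞 ≤ H.hodgeLie ∧
      (∀ X ∈ 𝔞, ∀ Y ∈ 𝔞, X * Y - Y * X ∈ 𝔞) ∧
      (∃ Θ ∈ Submodule.span ℂ ((fun X : Module.End ℚ V => X.baseChange ℂ) '' (𝔞 : Set (Module.End ℚ V))),
        ∀ p, ∀ x ∈ H.piece p (n - p), Θ x = ((2 * p - n : ℤ) : ℂ) • x) ∧ ¬ H.hodgeLie ≤ 𝔞 := by
  classical
  obtain ⟨hbr𝔥, -, -, Θ, hΘ, hΘ𝔥⟩ := hodgeLie_standing H ψ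
  have hΘeq : Θ = Θ₀ := linearMap_ext_of_piece H fun p x hx => by rw [hΘ p x hx, hΘ₀ p x hx]
  subst hΘeq
  set 𝔷 := H.hodgeLie ⊓ Subalgebra.toSubmodule H.endAlg with h𝔷
  set 𝔡 := Submodule.span ℚ {B | ∃ X ∈ H.hodgeLie, ∃ Y ∈ H.hodgeLie, X * Y - Y * X = B} with h𝔡
  have h𝔡le : 𝔡 ≤ H.hodgeLie := Literature.Algebra.Lie.TraceSeparating.derived_le H.hodgeLie hbr𝔥
  obtain ⟨hc𝔥, hcE⟩ := Submodule.mem_inf.1 hc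
  have hcc : ∀ Y ∈ H.hodgeLie, c * Y = Y * c := fun Y hY => (H.commute_of_mem_hodgeLie hY ⟨c, hcE⟩).symm
  -- the trace functional `x ↦ tr(c x)` and its kernel
  let f : Module.End ℚ V →ₗ[ℚ] ℚ := (LinearMap.trace ℚ V).comp (LinearMap.mulLeft ℚ c)
  have hf : ∀ x, f x = LinearMap.trace ℚ V (c * x) := fun x => rfl
  set K := LinearMap.ker f with hK
  have hcc0 : LinearMap.trace ℚ V (c * c) ≠ 0 := fun h =>
    hc0 (AnyWeight.hodgeLie_center_anisotropic H ψ c hc𝔥 hcc h)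
  refine ⟨𝔡 ⊔ 𝔷 ⊓ K, sup_le h𝔡le (inf_le_left.trans inf_le_left), ?_, ?_, ?_⟩
  · -- bracket-closed: the central parts drop out
    intro X hX Y hY
    obtain ⟨d, hd, x, hx, rfl⟩ := Submodule.mem_sup.1 hX
    obtain ⟨d', hd', x', hx', rfl⟩ := Submodule.mem_sup.1 hY
    have hxE := (Submodule.mem_inf.1 (Submodule.mem_inf.1 hx).1).2
    have hx'E := (Submodule.mem_inf.1 (Submodule.mem_inf.1 hx').1).2
    have hxc : ∀ Y ∈ H.hodgeLie, x * Y = Y * x := fun Y hY => (H.commute_of_mem_hodgeLie hY ⟨x, hxE⟩).symm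
    have hx'c : ∀ Y ∈ H.hodgeLie, x' * Y = Y * x' := fun Y hY => (H.commute_of_mem_hodgeLie hY ⟨x', hx'E⟩).symm
    have hd𝔥 := h𝔡le hd
    have hd'𝔥 := h𝔡le hd'
    have hx𝔥 := (Submodule.mem_inf.1 (Submodule.mem_inf.1 hx).1).1
    have hx'𝔥 := (Submodule.mem_inf.1 (Submodule.mem_inf.1 hx').1).1
    have hcalc : (d + x) * (d' + x') - (d' + x') * (d + x) = d * d' - d' * d := by
      rw [add_mul, mul_add, mul_add, add_mul, mul_add, mul_add, hxc d' hd'𝔥, hxc x' hx'𝔥, ← hx'c d hd𝔥]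
      abel
    rw [hcalc]
    exact Submodule.mem_sup_left (Literature.Algebra.Lie.TraceSeparating.commutator_mem_derived H.hodgeLie hd𝔥 hd'𝔥)
  · -- `Θ ∈ (𝔡 ⊕ (𝔷 ∩ K)) ⊗ ℂ`
    refine ⟨Θ, ?_, hΘ⟩
    have hΘ' : Θ ∈ Submodule.span ℂ ((fun X : Module.End ℚ V => X.baseChange ℂ) ''
        ((𝔷 ⊔ 𝔡 : Submodule ℚ (Module.End ℚ V)) : Set (Module.End ℚ V))) := by
      rw [AnyWeight.hodgeLie_center_sup_derived_eq H ψ]; exact hΘ𝔥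
    obtain ⟨Z, hZ, D, hD, hZD⟩ := Submodule.mem_sup.1 (spanC_sup_le 𝔷 𝔡 hΘ')
    have hD0 : LinearMap.trace ℂ (ℂ ⊗[ℚ] V) (c.baseChange ℂ * D) = 0 :=
      trace_baseChange_mul_eq_zero_of_mem_spanC 𝔡
        (fun B hB => Literature.Algebra.Lie.TraceSeparating.trace_mul_eq_zero_of_central_of_mem_derived H.hodgeLie hcc hB) hD
    have hZ0 : LinearMap.trace ℂ (ℂ ⊗[ℚ] V) (c.baseChange ℂ * Z) = 0 := by
      have h := htr
      rw [← hZD, mul_add, map_add, hD0, add_zero] at h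
      exact h
    -- `𝔷 = ℚ c ⊕ (𝔷 ∩ K)`: split `Z` accordingly
    set z₁ : Module.End ℚ V := (LinearMap.trace ℚ V (c * c))⁻¹ • c with hz₁
    have hz₁tr : LinearMap.trace ℚ V (c * z₁) = 1 := by
      rw [hz₁, mul_smul_comm, map_smul, smul_eq_mul, inv_mul_cancel₀ hcc0]
    have hsplit : ∀ x ∈ 𝔷, x - LinearMap.trace ℚ V (c * x) • z₁ ∈ 𝔷 ⊓ K := by
      intro x hx
      refine Submodule.mem_inf.2 ⟨𝔷.sub_mem hx (𝔷.smul_mem _ (by rw [hz₁]; exact 𝔷.smul_mem _ hc)), ?_⟩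
      rw [hK, LinearMap.mem_ker, hf, mul_sub, map_sub, mul_smul_comm, map_smul, hz₁tr, smul_eq_mul, mul_one, sub_self]
    have hZsplit : ∀ Y ∈ Submodule.span ℂ ((fun X : Module.End ℚ V => X.baseChange ℂ) '' (𝔷 : Set (Module.End ℚ V))),
        ∃ a : ℂ, Y - a • z₁.baseChange ℂ ∈
          Submodule.span ℂ ((fun X : Module.End ℚ V => X.baseChange ℂ) '' ((𝔷 ⊓ K : Submodule ℚ (Module.End ℚ V)) : Set (Module.End ℚ V))) := by
      intro Y hY
      induction hY using Submodule.span_induction with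
      | mem Y hY =>
        obtain ⟨x, hx, rfl⟩ := hY
        refine ⟨algebraMap ℚ ℂ (LinearMap.trace ℚ V (c * x)), ?_⟩
        have h := hsplit x hx
        rw [algebraMap_smul, ← LinearMap.baseChange_smul, ← LinearMap.baseChange_sub]
        exact Submodule.subset_span ⟨_, h, rfl⟩
      | zero => exact ⟨0, by rw [zero_smul, sub_zero]; exact Submodule.zero_mem _⟩
      | add Y Y' _ _ hY hY' =>
        obtain ⟨a, ha⟩ := hY
        obtain ⟨a', ha'⟩ := hY'
        refine ⟨a + a', ?_⟩
        have h := Submodule.add_mem _ ha ha'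
        have he : Y + Y' - (a + a') • z₁.baseChange ℂ = Y - a • z₁.baseChange ℂ + (Y' - a' • z₁.baseChange ℂ) := by
          rw [add_smul]; abel
        rw [he]; exact h
      | smul b Y _ hY =>
        obtain ⟨a, ha⟩ := hY
        refine ⟨b * a, ?_⟩
        have h := Submodule.smul_mem _ b ha
        rwa [smul_sub, smul_smul] at h
    obtain ⟨a, ha⟩ := hZsplit Z hZ
    have htrK : ∀ Y ∈ Submodule.span ℂ ((fun X : Module.End ℚ V => X.baseChange ℂ) ''
        ((𝔷 ⊓ K : Submodule ℚ (Module.End ℚ V)) : Set (Module.End ℚ V))), LinearMap.trace ℂ (ℂ ⊗[ℚ] V) (c.baseChange ℂ * Y) = 0 :=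
      fun Y hY => trace_baseChange_mul_eq_zero_of_mem_spanC (𝔷 ⊓ K) (fun x hx => (Submodule.mem_inf.1 hx).2) hY
    have ha0 : a = 0 := by
      have h1 := htrK _ ha
      rw [mul_sub, map_sub, hZ0, mul_smul_comm, map_smul, ← LinearMap.baseChange_mul, LinearMap.trace_baseChange, hz₁tr,
        map_one, smul_eq_mul, mul_one, zero_sub, neg_eq_zero] at h1
      exact h1
    rw [ha0, zero_smul, sub_zero] at ha
    rw [← hZD]
    refine Submodule.add_mem _ ?_ ?_
    · exact Submodule.span_mono (Set.image_mono fun x hx => Submodule.mem_sup_right hx) ha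
    · exact Submodule.span_mono (Set.image_mono fun x hx => Submodule.mem_sup_left hx) hD
  · -- `c ∉ 𝔡 ⊕ (𝔷 ∩ K)`
    intro hle
    obtain ⟨d, hd, x, hx, hdx⟩ := Submodule.mem_sup.1 (hle hc𝔥)
    have hd𝔷 : d ∈ 𝔷 := by
      have h : d = c - x := by rw [← hdx, add_sub_cancel_right]
      rw [h]; exact 𝔷.sub_mem hc (Submodule.mem_inf.1 hx).1
    have hd0 : d = 0 := by
      have h := Submodule.mem_inf.2 ⟨hd𝔷, hd⟩
      rwa [h𝔷, hodgeLie_center_inf_derived_eq_bot H ψ, Submodule.mem_bot] at h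
    rw [hd0, zero_add] at hdx
    subst hdx
    exact hcc0 ((Submodule.mem_inf.1 hx).2)

/-- **The exact criterion: `H` is `Θ`-rigid iff `tr(c_ℂ ∘ Θ) ≠ 0` for every non-zero central `c ∈ 𝔥(H) ∩ End_Hdg`.**
[cite: MoonenZarhin1999LowDim, §3 (3.1)] [cite: Deligne1982HodgeCycles, I §3 Prop. 3.6] [cite: Gordon1997, 1.13.2] -/
theorem rigid_iff_forall_center_trace_theta (H : HodgeStructure V n) (hH : H.IsPolarizable) {Θ₀ : Module.End ℂ (ℂ ⊗[ℚ] V)}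
    (hΘ₀ : ∀ p, ∀ x ∈ H.piece p (n - p), Θ₀ x = ((2 * p - n : ℤ) : ℂ) • x) :
    (∀ 𝔞 : Submodule ℚ (Module.End ℚ V), 𝔞 ≤ H.hodgeLie →
      (∀ X ∈ 𝔞, ∀ Y ∈ 𝔞, X * Y - Y * X ∈ 𝔞) →
      (∃ Θ ∈ Submodule.span ℂ ((fun X : Module.End ℚ V => X.baseChange ℂ) '' (𝔞 : Set (Module.End ℚ V))),
        ∀ p, ∀ x ∈ H.piece p (n - p), Θ x = ((2 * p - n : ℤ) : ℂ) • x) → H.hodgeLie ≤ 𝔞) ↔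
    (∀ c ∈ H.hodgeLie ⊓ Subalgebra.toSubmodule H.endAlg,
      LinearMap.trace ℂ (ℂ ⊗[ℚ] V) (c.baseChange ℂ * Θ₀) = 0 → c = 0) := by
  obtain ⟨ψ⟩ := hH
  refine ⟨fun hrig c hc htr => ?_, fun htest => rigid_of_forall_center_trace_theta H ⟨ψ⟩ hΘ₀ htest⟩
  by_contra hc0
  obtain ⟨𝔞, h𝔞, hbr, hΘ, hnot⟩ := not_rigid_of_center_trace_theta_eq_zero H ψ hΘ₀ hc hc0 htr
  exact hnot (hrig 𝔞 h𝔞 hbr hΘ)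

end HodgeStructure

end Literature.AlgebraicGeometry.Motives

end
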